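import Summits.RiemannHypothesis.RiemannHypothesis.Theses.WeilComb
import Literature.NumberTheory.LFunctions.UniformWeilPositivityRH
import Literature.NumberTheory.LFunctions.WeilExplicitProofs
import Literature.NumberTheory.LFunctions.WeilExplicitFormulaProofs

/-!
# `WeilComb.CombSubcritical` (Theorem A, item stmt-RiemannHypothesis-1025): load-bearing hypotheses

Negative-side knowledge for the crux `CombSubcritical` of route `RiemannHypothesis/WeilComb`
(refuter / cdisprove seat; helper file, supports 1025; no new definitions, everything inline).

The crux: `∃ c₀ > 0, ∀ φ Weil test, tsupport φ ⊆ [-1,1] → ∀ ε > 0, ∀ M a, ε·M ≤ c₀ →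
0 ≤ Re Q(g)`, `g = x ↦ Σ_{m=1}^{M} a m · ε⁻¹ φ((x − log m)/ε)` (a "comb"), `Q = weilQuadratic`.

* `weilComb_isWeilTest_comb` — every comb on a Weil test is a Weil test; hence
  `weilComb_not_riemannHypothesis_of_not_combSubcritical`: a refutation of the crux would refute the
  Riemann hypothesis (explicit formula + Weil's easy direction, both in tree).  There is therefore
  no unconditional disproof of Theorem A short of `¬RH`; the window `ε·M ≤ c₀` matters only for an
  unconditional PROOF, not for truth.
* `weilComb_combSubcritical_withoutSupport_iff_riemannHypothesis` — dropping the normalisation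
  `tsupport φ ⊆ [-1,1]` turns the crux into a statement EQUIVALENT to RH (witness `M = 1`,
  `ε = c₀`, `φ u = c₀ · g(c₀ u)` reproduces an arbitrary Weil test `g`).
* `weilComb_combSubcritical_withoutWindow_iff_riemannHypothesis` — dropping the window
  `ε·M ≤ c₀` likewise gives a statement equivalent to RH (`M = 1`, `ε = a`, `φ u = a · g(a u)` has
  `tsupport ⊆ [-1,1]` when `tsupport g ⊆ [-a,a]`).

So both structural hypotheses are exactly what places the crux strictly below the route target
(uniform Weil positivity, `riemannHypothesis_iff_forall_weilPositivityOn`); a planner must not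
restate the item without either of them.
-/

noncomputable section

open scoped BigOperators ComplexConjugate ContDiff
open Complex MeasureTheory Set Filter

namespace Summit.RiemannHypothesis.RiemannHypothesis.Theorems

open Literature.NumberTheory.LFunctions
open Summit.RiemannHypothesis.RiemannHypothesis.Theses.WeilComb

/-- Every comb `x ↦ Σ_{m ≤ M} a m · ε⁻¹ φ((x − log m)/ε)` built on a Weil test `φ` (`ε ≠ 0`) is a
Weil test: smooth as a finite sum of smooth functions of affine maps, compactly supported as a
finite sum of compactly supported functions composed with affine homeomorphisms. [folklore] -/
theorem weilComb_isWeilTest_comb {φ : ℝ → ℂ} (hφ : IsWeilTest φ) {ε : ℝ} (hε : ε ≠ 0) (M : ℕ)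
    (a : ℕ → ℂ) :
    IsWeilTest (fun x : ℝ => ∑ m ∈ Finset.Icc 1 M, a m * ((ε : ℂ)⁻¹ * φ ((x - Real.log (m : ℝ)) / ε))) := by
  refine ⟨?_, ?_⟩
  · refine ContDiff.sum fun m _ => ?_
    refine contDiff_const.mul (contDiff_const.mul ?_)
    exact hφ.1.comp ((contDiff_id.sub contDiff_const).div_const ε)
  · have h1 : (fun x : ℝ => ∑ m ∈ Finset.Icc 1 M, a m * ((ε : ℂ)⁻¹ * φ ((x - Real.log (m : ℝ)) / ε))) =
        ∑ m ∈ Finset.Icc 1 M, fun x : ℝ => a m * ((ε : ℂ)⁻¹ * φ ((x - Real.log (m : ℝ)) / ε)) := by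
      ext x; simp [Finset.sum_apply]
    rw [h1]
    refine HasCompactSupport.finset_sum fun m _ => ?_
    have h2 : HasCompactSupport fun x : ℝ => φ ((x - Real.log (m : ℝ)) / ε) := by
      have h := hφ.2.comp_homeomorph (affineHomeomorph ε⁻¹ (-(Real.log (m : ℝ)) / ε) (inv_ne_zero hε))
      convert h using 1
      funext x
      simp only [Function.comp_apply, affineHomeomorph_apply]
      congr 1
      ring
    exact (h2.mul_left).mul_left

/-- **No unconditional disproof of Theorem A short of `¬RH`.** RH ⇒ Weil positivity
(`WeilPositivity.of_riemannHypothesis explicit_formula_holds`) ⇒ every comb has `Re Q ≥ 0`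
(`weilComb_isWeilTest_comb`), with no window at all; contrapositively a counterexample to the crux
refutes the Riemann hypothesis. [folklore] -/
theorem weilComb_not_riemannHypothesis_of_not_combSubcritical (h : ¬ CombSubcritical) :
    ¬ _root_.RiemannHypothesis := fun hRH =>
  h ⟨1, one_pos, fun _φ hφ _ _ε hε M a _ =>
    WeilPositivity.of_riemannHypothesis explicit_formula_holds hRH _
      (weilComb_isWeilTest_comb hφ hε.ne' M a)⟩

/-- The dilation `u ↦ c · g (c u)` (`c ≠ 0`) of a Weil test is a Weil test. [folklore] -/
theorem weilComb_isWeilTest_dilate {g : ℝ → ℂ} (hg : IsWeilTest g) {c : ℝ} (hc : c ≠ 0) :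
    IsWeilTest (fun u : ℝ => (c : ℂ) * g (c * u)) := by
  refine ⟨contDiff_const.mul (hg.1.comp (contDiff_const.mul contDiff_id)), ?_⟩
  have h : HasCompactSupport (g ∘ (Homeomorph.mulLeft₀ c hc)) := hg.2.comp_homeomorph _
  exact h.mul_left

/-- With one node (`M = 1`, `a = 1`, `ε = c`) the comb of the dilated test `u ↦ c · g(c u)` is
`g` itself (the form below is the β-reduced instance of the crux's comb). [folklore] -/
theorem weilComb_comb_one_dilate (g : ℝ → ℂ) {c : ℝ} (hc : c ≠ 0) :
    (fun x : ℝ => ∑ m ∈ Finset.Icc (1 : ℕ) 1,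
        (1 : ℂ) * ((c : ℂ)⁻¹ * ((c : ℂ) * g (c * ((x - Real.log (m : ℝ)) / c))))) = g := by
  funext x
  have hx : c * ((x - Real.log ((1 : ℕ) : ℝ)) / c) = x := by
    simp only [Nat.cast_one, Real.log_one, sub_zero]
    field_simp
  have hc' : (c : ℂ) ≠ 0 := by exact_mod_cast hc
  simp only [Finset.Icc_self, Finset.sum_singleton, one_mul, hx]
  field_simp

/-- Support of the dilation: `tsupport g ⊆ [-a, a]`, `0 < a` ⇒
`tsupport (u ↦ a · g(a u)) ⊆ [-1, 1]`. [folklore] -/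
theorem weilComb_tsupport_dilate_subset {g : ℝ → ℂ} {a : ℝ} (ha : 0 < a)
    (hg : tsupport g ⊆ Set.Icc (-a) a) :
    tsupport (fun u : ℝ => (a : ℂ) * g (a * u)) ⊆ Set.Icc (-1) 1 := by
  have h1 : tsupport (fun u : ℝ => (a : ℂ) * g (a * u)) ⊆
      tsupport (g ∘ (Homeomorph.mulLeft₀ a ha.ne')) :=
    tsupport_mul_subset_right
  refine h1.trans ?_
  rw [tsupport_comp_eq_preimage]
  intro u hu
  have hu' := hg hu
  simp only [Set.mem_Icc] at hu' ⊢
  have e : (Homeomorph.mulLeft₀ a ha.ne') u = a * u := rfl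
  rw [e] at hu'
  constructor <;> nlinarith [hu'.1, hu'.2]

/-- **LOAD-BEARING (support normalisation).** The crux `CombSubcritical` with the hypothesis
`tsupport φ ⊆ [-1,1]` dropped is EQUIVALENT to the Riemann hypothesis: (⇒) with `M = 1`,
`ε = c₀`, `a = 1` and `φ u = c₀ g(c₀ u)` the comb is an arbitrary Weil test `g`, giving
`WeilPositivity`, i.e. RH by Weil's criterion (`weil_criterion_holds`); (⇐) RH gives Weil
positivity of every comb. So without the normalisation the item is the route target in a
costume. [folklore] -/
theorem weilComb_combSubcritical_withoutSupport_iff_riemannHypothesis :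
    (∃ c₀ : ℝ, 0 < c₀ ∧ ∀ φ : ℝ → ℂ, IsWeilTest φ → ∀ ε : ℝ, 0 < ε → ∀ (M : ℕ) (a : ℕ → ℂ),
      ε * M ≤ c₀ → 0 ≤ (weilQuadratic (fun x : ℝ => ∑ m ∈ Finset.Icc 1 M,
        a m * ((ε : ℂ)⁻¹ * φ ((x - Real.log (m : ℝ)) / ε)))).re) ↔ _root_.RiemannHypothesis := by
  constructor
  · rintro ⟨c₀, hc₀, h⟩
    refine weil_criterion_holds.2 fun g hg => ?_
    have key := h (fun u : ℝ => (c₀ : ℂ) * g (c₀ * u)) (weilComb_isWeilTest_dilate hg hc₀.ne')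
      c₀ hc₀ 1 (fun _ => 1) (by simp)
    rwa [weilComb_comb_one_dilate g hc₀.ne'] at key
  · intro hRH
    exact ⟨1, one_pos, fun _φ hφ _ε hε M a _ =>
      WeilPositivity.of_riemannHypothesis explicit_formula_holds hRH _
        (weilComb_isWeilTest_comb hφ hε.ne' M a)⟩

/-- **LOAD-BEARING (window).** The crux `CombSubcritical` with the window `ε·M ≤ c₀` dropped
(then `∃ c₀` is idle) is EQUIVALENT to the Riemann hypothesis: (⇒) for a Weil test `g` with
`tsupport g ⊆ [-a, a]`, `a > 0`, take `M = 1`, `ε = a`, `φ u = a g(a u)` (a Weil test with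
`tsupport φ ⊆ [-1,1]`): the comb is `g`, so `WeilPositivityOn a` holds for every `a > 0`, i.e. RH
(`riemannHypothesis_iff_forall_weilPositivityOn`); (⇐) RH gives Weil positivity of every comb.
[folklore] -/
theorem weilComb_combSubcritical_withoutWindow_iff_riemannHypothesis :
    (∀ φ : ℝ → ℂ, IsWeilTest φ → tsupport φ ⊆ Set.Icc (-1) 1 → ∀ ε : ℝ, 0 < ε →
      ∀ (M : ℕ) (a : ℕ → ℂ), 0 ≤ (weilQuadratic (fun x : ℝ => ∑ m ∈ Finset.Icc 1 M,
        a m * ((ε : ℂ)⁻¹ * φ ((x - Real.log (m : ℝ)) / ε)))).re) ↔ _root_.RiemannHypothesis := by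
  constructor
  · intro h
    refine riemannHypothesis_iff_forall_weilPositivityOn.2 fun a ha g hg hga => ?_
    have key := h (fun u : ℝ => (a : ℂ) * g (a * u)) (weilComb_isWeilTest_dilate hg ha.ne')
      (weilComb_tsupport_dilate_subset ha hga) a ha 1 (fun _ => 1)
    rwa [weilComb_comb_one_dilate g ha.ne'] at key
  · intro hRH _φ hφ _ _ε hε M a
    exact WeilPositivity.of_riemannHypothesis explicit_formula_holds hRH _
      (weilComb_isWeilTest_comb hφ hε.ne' M a)

end Summit.RiemannHypothesis.RiemannHypothesis.Theorems

end
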